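import Summits.AtomisticToContinuum.BoseEinsteinCondensation.Theses.BECSubharmonicContinuation
import Summits.AtomisticToContinuum.BoseEinsteinCondensation.Theorems.BECSubharmonicContinuationCoreDeficitBoundsWeight
import Summits.AtomisticToContinuum.BoseEinsteinCondensation.Theorems.BECSubharmonicContinuationCoreDeficitBoundsKernelTent
import Summits.AtomisticToContinuum.BoseEinsteinCondensation.Theorems.BECSubharmonicContinuationCoreDeficitBoundsKernelBall
import Summits.AtomisticToContinuum.BoseEinsteinCondensation.Theorems.BECSubharmonicContinuationCoreDeficitBoundsFourier
import HarnessLib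

/-!
# Route `BECSubharmonicContinuation`, support `CoreDeficitBounds` (stmt-AtomisticToContinuum-9004):
# the core-deficit bounds — proof

For `L > 0`, any periodic trial state `Ψ` of `N` bosons, any particle `i` and `R > 0`, the core
potential `D(R) = (4π)⁻¹ ∫_{B(0,R)} H(y)/|y| dy` of the gradient correlation
`H(y) = Re ∑ₖ ∫ conj ∂_{i,k}Ψ(X^{i→xᵢ+y}) ∂_{i,k}Ψ(X) dX` satisfies

* (a) `D(R) ≤ H(0) R²/2`, and
* (b) `D(R) ≤ 8 (1 - R⁻³ ∫ ∏ₖ(1 - |yₖ|/R)₊ G(y) dy)`, `G(y) = Re ∫ conj Ψ(X^{i→xᵢ+y}) Ψ(X) dX`.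

Proof (`CoreDeficitBounds_proof`). By the Fourier representation on `(ℝ/ℤ)^{3N}`
(`…CoreDeficitBoundsFourier`) `G(y) = ∑ₙ aₙ cos(κₙ·y)`, `H(y) = ∑ₙ |κₙ|² aₙ cos(κₙ·y)` with
`aₙ = L^{3N}|ĉₙ(Ψ)|² ≥ 0`, `∑ₙ aₙ = 1`, `κₙ = 2πn(i,·)/L`; dominated convergence exchanges the mode
sum with the `y`-integrals (the kernels `1_{B_R}/|y|` and the tent are integrable, the weights
summable), and the kernel identities `|κ|²(4π)⁻¹∫_{B_R} cos(κ·y)/|y| dy = 1 - cos(|κ|R)`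
(`…KernelBall`) and `R⁻³∫ ∏(1-|yₖ|/R)₊ cos(κ·y) dy = ∏ⱼ sinc²(κⱼR/2)` (`…KernelTent`) give
`D(R) = ∑ₙ aₙ(1 - cos(|κₙ|R))` and `1 - R⁻³∫tent·G = ∑ₙ aₙ(1 - ∏ⱼ sinc²(κₙ,ⱼR/2))`. Then (a) is
`1 - cos x ≤ x²/2` and (b) is the weight inequality `1 - cos|u| ≤ 8(1 - ∏ⱼ sinc²(uⱼ/2))`
(`…Weight`), termwise.
-/

noncomputable section

open MeasureTheory Set Filter Complex Metric Real
open scoped ENNReal NNReal Topology ComplexConjugate BigOperators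

namespace Summit.AtomisticToContinuum.BoseEinsteinCondensation.Theorems.CoreDeficitBounds

open Literature.MathematicalPhysics.QuantumManyBody.BoseGas

variable {N : ℕ} {L : ℝ}

/-! Throughout, the wave vectors are abstracted as a family `κ : ℤ^{3N} → ℝ³` with
`κ n k = 2π n(i,k)/L` (hypothesis `hκ`); the closing theorem instantiates it. -/

section WaveVector

variable {i : Fin N} {κ : (Fin N × Fin 3 → ℤ) → Space}

/-- The phase `κₙ · y = ∑ₖ 2π n(i,k) yₖ / L`. -/
theorem sum_waveVec_mul (hκ : ∀ n k, κ n k = 2 * Real.pi * (n (i, k) : ℝ) / L)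
    (n : Fin N × Fin 3 → ℤ) (y : Space) :
    ∑ k, κ n k * y k = ∑ k, 2 * Real.pi * (n (i, k) : ℝ) * y k / L := by
  refine Finset.sum_congr rfl fun k _ => ?_
  rw [hκ]
  ring

/-- The squared wave number `|κₙ|² = ∑ₖ (2π n(i,k)/L)²`. -/
theorem norm_sq_waveVec (hκ : ∀ n k, κ n k = 2 * Real.pi * (n (i, k) : ℝ) / L)
    (n : Fin N × Fin 3 → ℤ) :
    ‖κ n‖ ^ 2 = ∑ k, (2 * Real.pi * (n (i, k) : ℝ) / L) ^ 2 := by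
  rw [EuclideanSpace.real_norm_sq_eq]
  simp only [hκ]

/-- The phase is continuous in `y`. -/
theorem continuous_cos_waveVec (κ : (Fin N × Fin 3 → ℤ) → Space) (n : Fin N × Fin 3 → ℤ) :
    Continuous fun y : Space => Real.cos (∑ k, κ n k * y k) :=
  Real.continuous_cos.comp (continuous_finsetSum _ fun k _ =>
    continuous_const.mul (PiLp.continuous_apply 2 (fun _ : Fin 3 => ℝ) k))

/-- **The gradient correlation in momentum space, wave-vector form**:
`H(y) = ∑ₙ aₙ |κₙ|² cos(κₙ·y)`. -/
theorem hasSum_H (hL : 0 < L) (Ψ : PeriodicTrialState N L)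
    (hκ : ∀ n k, κ n k = 2 * Real.pi * (n (i, k) : ℝ) / L) (y : Space) :
    HasSum (fun n : Fin N × Fin 3 → ℤ => (L ^ 3) ^ N * ‖configFourierCoeff L Ψ.ψ n‖ ^ 2 *
        ‖κ n‖ ^ 2 * Real.cos (∑ k, κ n k * y k))
      (∑ k : Fin 3, ∫ X in cellN N L,
        conj (fderiv ℝ Ψ.ψ (Function.update X i (X i + y)) (Pi.single i (EuclideanSpace.single k (1 : ℝ)))) *
          fderiv ℝ Ψ.ψ X (Pi.single i (EuclideanSpace.single k (1 : ℝ)))).re := by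
  refine (hasSum_gradientCorrelation hL Ψ i y).congr_fun fun n => ?_
  rw [norm_sq_waveVec hκ, sum_waveVec_mul hκ]

/-- **The translation correlation in momentum space, wave-vector form**:
`G(y) = ∑ₙ aₙ cos(κₙ·y)`. -/
theorem hasSum_G (hL : 0 < L) (Ψ : PeriodicTrialState N L)
    (hκ : ∀ n k, κ n k = 2 * Real.pi * (n (i, k) : ℝ) / L) (y : Space) :
    HasSum (fun n : Fin N × Fin 3 → ℤ => (L ^ 3) ^ N * ‖configFourierCoeff L Ψ.ψ n‖ ^ 2 *
        Real.cos (∑ k, κ n k * y k))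
      (∫ X in cellN N L, conj (Ψ.ψ (Function.update X i (X i + y))) * Ψ.ψ X).re := by
  refine (hasSum_translationCorrelation hL Ψ i y).congr_fun fun n => ?_
  rw [sum_waveVec_mul hκ]

/-- **Summability of the kinetic weights**: `∑ₙ aₙ |κₙ|² = H(0) < ∞`. -/
theorem hasSum_H_zero (hL : 0 < L) (Ψ : PeriodicTrialState N L)
    (hκ : ∀ n k, κ n k = 2 * Real.pi * (n (i, k) : ℝ) / L) :
    HasSum (fun n : Fin N × Fin 3 → ℤ => (L ^ 3) ^ N * ‖configFourierCoeff L Ψ.ψ n‖ ^ 2 *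
        ‖κ n‖ ^ 2)
      (∑ k : Fin 3, ∫ X in cellN N L,
        conj (fderiv ℝ Ψ.ψ (Function.update X i (X i + 0)) (Pi.single i (EuclideanSpace.single k (1 : ℝ)))) *
          fderiv ℝ Ψ.ψ X (Pi.single i (EuclideanSpace.single k (1 : ℝ)))).re := by
  refine (hasSum_H hL Ψ hκ 0).congr_fun fun n => ?_
  simp

/-- **The core potential in momentum space.** With `D(R) = (4π)⁻¹∫_{B(0,R)} H(y)/|y| dy`,
`D(R) = ∑ₙ aₙ (1 - cos(|κₙ| R))` (dominated convergence with the integrable kernel `1/|y|` on the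
ball and the summable weights `aₙ|κₙ|²`, then the truncated Newton kernel identity). -/
theorem hasSum_corePotential (hL : 0 < L) (Ψ : PeriodicTrialState N L)
    (hκ : ∀ n k, κ n k = 2 * Real.pi * (n (i, k) : ℝ) / L) {R : ℝ} (hR : 0 < R) :
    HasSum (fun n : Fin N × Fin 3 → ℤ => (L ^ 3) ^ N * ‖configFourierCoeff L Ψ.ψ n‖ ^ 2 *
        (1 - Real.cos (‖κ n‖ * R)))
      ((4 * Real.pi)⁻¹ * ∫ y in ball (0 : Space) R, (∑ k : Fin 3, ∫ X in cellN N L,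
        conj (fderiv ℝ Ψ.ψ (Function.update X i (X i + y)) (Pi.single i (EuclideanSpace.single k (1 : ℝ)))) *
          fderiv ℝ Ψ.ψ X (Pi.single i (EuclideanSpace.single k (1 : ℝ)))).re / ‖y‖) := by
  -- abbreviations
  set a : (Fin N × Fin 3 → ℤ) → ℝ := fun n => (L ^ 3) ^ N * ‖configFourierCoeff L Ψ.ψ n‖ ^ 2
    with ha
  have ha0 : ∀ n, 0 ≤ a n := fun n => by rw [ha]; positivity
  set w : (Fin N × Fin 3 → ℤ) → ℝ := fun n => a n * ‖κ n‖ ^ 2 with hw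
  have hw0 : ∀ n, 0 ≤ w n := fun n => by rw [hw]; exact mul_nonneg (ha0 n) (sq_nonneg _)
  have hwsum : Summable w := (hasSum_H_zero hL Ψ hκ).summable
  -- dominated convergence on the ball
  have hDC := hasSum_integral_of_dominated_convergence
    (μ := volume.restrict (ball (0 : Space) R))
    (F := fun n y => w n * Real.cos (∑ k, κ n k * y k) / ‖y‖)
    (f := fun y => (∑ k : Fin 3, ∫ X in cellN N L,
        conj (fderiv ℝ Ψ.ψ (Function.update X i (X i + y)) (Pi.single i (EuclideanSpace.single k (1 : ℝ)))) *
          fderiv ℝ Ψ.ψ X (Pi.single i (EuclideanSpace.single k (1 : ℝ)))).re / ‖y‖)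
    (fun n y => w n * ‖y‖⁻¹) (fun n => ?_) (fun n => ?_) ?_ ?_ ?_
  rotate_left
  · -- measurability
    exact ((continuous_const.mul (continuous_cos_waveVec κ n)).measurable.div
      continuous_norm.measurable).aestronglyMeasurable
  · -- domination
    refine ae_of_all _ fun y => ?_
    rw [Real.norm_eq_abs, abs_div, abs_mul, abs_norm, abs_of_nonneg (hw0 n), div_eq_mul_inv]
    exact mul_le_mul_of_nonneg_right (mul_le_of_le_one_right (hw0 n) (Real.abs_cos_le_one _))
      (inv_nonneg.2 (norm_nonneg _))
  · -- summability of the bound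
    exact ae_of_all _ fun y => hwsum.mul_right _
  · -- integrability of the bound
    have h1 : (fun y : Space => ∑' n, w n * ‖y‖⁻¹) = fun y => (∑' n, w n) * ‖y‖⁻¹ := by
      funext y; exact tsum_mul_right
    rw [h1]
    exact (integrableOn_inv_norm_ball R).const_mul _
  · -- pointwise convergence
    exact ae_of_all _ fun y => (hasSum_H hL Ψ hκ y).div_const ‖y‖
  -- evaluate the mode integrals
  have hDC2 := hDC.mul_left (4 * Real.pi)⁻¹
  refine hDC2.congr_fun fun n => ?_
  simp only [hw]
  have hI : ∫ y in ball (0 : Space) R, a n * ‖κ n‖ ^ 2 * Real.cos (∑ k, κ n k * y k) / ‖y‖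
      = a n * ‖κ n‖ ^ 2 * ∫ y in ball (0 : Space) R, Real.cos (∑ k, κ n k * y k) / ‖y‖ := by
    rw [← MeasureTheory.integral_const_mul]
    refine integral_congr_ae (ae_of_all _ fun y => ?_)
    ring
  rw [hI, ← norm_sq_mul_integral_ball_cos_div_norm (κ n) hR]
  ring

/-- **The window average in momentum space.** With the translate-averaged cube window
`W = R⁻³∫ ∏ₖ(1 - |yₖ|/R)₊ G(y) dy`, `W = ∑ₙ aₙ ∏ⱼ sinc²(κₙ,ⱼ R/2)` (dominated convergence with
the integrable tent and the summable weights `aₙ`, then the Fejér identity). -/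
theorem hasSum_window (hL : 0 < L) (Ψ : PeriodicTrialState N L)
    (hκ : ∀ n k, κ n k = 2 * Real.pi * (n (i, k) : ℝ) / L) {R : ℝ} (hR : 0 < R) :
    HasSum (fun n : Fin N × Fin 3 → ℤ => (L ^ 3) ^ N * ‖configFourierCoeff L Ψ.ψ n‖ ^ 2 *
        ∏ j, Real.sinc (κ n j * R / 2) ^ 2)
      (R⁻¹ ^ 3 * ∫ y : Space, (∏ k : Fin 3, max (1 - |y k| / R) 0) *
        (∫ X in cellN N L, conj (Ψ.ψ (Function.update X i (X i + y))) * Ψ.ψ X).re) := by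
  set a : (Fin N × Fin 3 → ℤ) → ℝ := fun n => (L ^ 3) ^ N * ‖configFourierCoeff L Ψ.ψ n‖ ^ 2
    with ha
  have ha0 : ∀ n, 0 ≤ a n := fun n => by rw [ha]; positivity
  have hasum : HasSum a 1 := hasSum_coeff hL Ψ
  have hDC := hasSum_integral_of_dominated_convergence (μ := (volume : Measure Space))
    (F := fun n y => (∏ k : Fin 3, max (1 - |y k| / R) 0) * (a n * Real.cos (∑ k, κ n k * y k)))
    (f := fun y => (∏ k : Fin 3, max (1 - |y k| / R) 0) *
        (∫ X in cellN N L, conj (Ψ.ψ (Function.update X i (X i + y))) * Ψ.ψ X).re)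
    (fun n y => a n * ∏ k : Fin 3, max (1 - |y k| / R) 0) (fun n => ?_) (fun n => ?_) ?_ ?_ ?_
  rotate_left
  · exact ((continuous_tent R).mul (continuous_const.mul (continuous_cos_waveVec κ n))).aestronglyMeasurable
  · refine ae_of_all _ fun y => ?_
    rw [Real.norm_eq_abs, abs_mul, abs_mul, abs_of_nonneg (tent_nonneg R y), abs_of_nonneg (ha0 n),
      mul_comm]
    exact mul_le_mul_of_nonneg_right (mul_le_of_le_one_right (ha0 n) (Real.abs_cos_le_one _))
      (tent_nonneg R y)
  · exact ae_of_all _ fun y => hasum.summable.mul_right _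
  · have h1 : (fun y : Space => ∑' n, a n * ∏ k : Fin 3, max (1 - |y k| / R) 0) =
        fun y => (∑' n, a n) * ∏ k : Fin 3, max (1 - |y k| / R) 0 := by
      funext y; exact tsum_mul_right
    rw [h1]
    exact (integrable_tent hR).const_mul _
  · exact ae_of_all _ fun y => (hasSum_G hL Ψ hκ y).mul_left _
  have hDC2 := hDC.mul_left (R⁻¹ ^ 3)
  refine hDC2.congr_fun fun n => ?_
  have hI : ∫ y : Space, (∏ k : Fin 3, max (1 - |y k| / R) 0) * (a n * Real.cos (∑ k, κ n k * y k))
      = a n * ∫ y : Space, (∏ k : Fin 3, max (1 - |y k| / R) 0) * Real.cos (∑ k, κ n k * y k) := by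
    rw [← MeasureTheory.integral_const_mul]
    refine integral_congr_ae (ae_of_all _ fun y => ?_)
    ring
  rw [hI, integral_tent_mul_cos (κ n) hR]
  have hR3 : R⁻¹ ^ 3 * R ^ 3 = 1 := by rw [inv_pow, inv_mul_cancel₀ (pow_ne_zero 3 hR.ne')]
  calc a n * ∏ j, Real.sinc (κ n j * R / 2) ^ 2
      = (R⁻¹ ^ 3 * R ^ 3) * (a n * ∏ j, Real.sinc (κ n j * R / 2) ^ 2) := by rw [hR3, one_mul]
    _ = R⁻¹ ^ 3 * (a n * (R ^ 3 * ∏ j, Real.sinc (κ n j * R / 2) ^ 2)) := by ring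

end WaveVector

/-- **The core-deficit bounds** (route `BECSubharmonicContinuation`, support `CoreDeficitBounds`,
stmt-AtomisticToContinuum-9004). For `L > 0`, every periodic trial state `Ψ`, particle `i` and
`R > 0`: (a) `(4π)⁻¹∫_{B(0,R)} H/|y| ≤ H(0)R²/2` and
(b) `(4π)⁻¹∫_{B(0,R)} H/|y| ≤ 8(1 - R⁻³∫∏ₖ(1-|yₖ|/R)₊ G)`, by the momentum-space identities
`D(R) = ∑ₙ aₙ(1 - cos|κₙ|R)`, `H(0) = ∑ₙ aₙ|κₙ|²`, `1 - W = ∑ₙ aₙ(1 - ∏ⱼsinc²(κₙ,ⱼR/2))`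
(`∑ₙ aₙ = 1`) and the termwise inequalities `1 - cos x ≤ x²/2`,
`1 - cos|u| ≤ 8(1 - ∏ⱼ sinc²(uⱼ/2))`. -/
theorem _root_.Summit.AtomisticToContinuum.BoseEinsteinCondensation.Theorems.CoreDeficitBounds_proof :
    Summit.AtomisticToContinuum.BoseEinsteinCondensation.Theses.BECSubharmonicContinuation.CoreDeficitBounds := by
  intro N L hL Ψ i R hR
  beta_reduce
  -- the wave vectors `κₙ = 2π n(i,·)/L`
  set κ : (Fin N × Fin 3 → ℤ) → Space :=
    fun n => WithLp.toLp 2 (fun k : Fin 3 => 2 * Real.pi * (n (i, k) : ℝ) / L) with hκdef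
  have hκ : ∀ n k, κ n k = 2 * Real.pi * (n (i, k) : ℝ) / L := fun n k => by
    rw [hκdef, PiLp.toLp_apply]
  have hD := hasSum_corePotential hL Ψ hκ hR
  have hH0 := hasSum_H_zero hL Ψ hκ
  have hW := hasSum_window hL Ψ hκ hR
  have ha := hasSum_coeff hL Ψ
  have ha0 : ∀ n : Fin N × Fin 3 → ℤ, 0 ≤ (L ^ 3) ^ N * ‖configFourierCoeff L Ψ.ψ n‖ ^ 2 :=
    fun n => by positivity
  refine ⟨?_, ?_⟩
  · -- (a): `1 - cos x ≤ x²/2`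
    have hcmp := hasSum_le (f := fun n : Fin N × Fin 3 → ℤ => (L ^ 3) ^ N *
        ‖configFourierCoeff L Ψ.ψ n‖ ^ 2 * (1 - Real.cos (‖κ n‖ * R)))
      (g := fun n => (L ^ 3) ^ N * ‖configFourierCoeff L Ψ.ψ n‖ ^ 2 * ‖κ n‖ ^ 2 * (R ^ 2 / 2))
      (fun n => ?_) hD (hH0.mul_right (R ^ 2 / 2))
    · simpa [mul_div_assoc] using hcmp
    · have h1 := Real.one_sub_sq_div_two_le_cos (x := ‖κ n‖ * R)
      have h2 : 1 - Real.cos (‖κ n‖ * R) ≤ ‖κ n‖ ^ 2 * (R ^ 2 / 2) := by nlinarith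
      calc (L ^ 3) ^ N * ‖configFourierCoeff L Ψ.ψ n‖ ^ 2 * (1 - Real.cos (‖κ n‖ * R))
          ≤ (L ^ 3) ^ N * ‖configFourierCoeff L Ψ.ψ n‖ ^ 2 * (‖κ n‖ ^ 2 * (R ^ 2 / 2)) :=
            mul_le_mul_of_nonneg_left h2 (ha0 n)
        _ = _ := by ring
  · -- (b): the weight inequality
    have hdef := (ha.sub hW).mul_left 8
    have hcmp := hasSum_le (f := fun n : Fin N × Fin 3 → ℤ => (L ^ 3) ^ N *
        ‖configFourierCoeff L Ψ.ψ n‖ ^ 2 * (1 - Real.cos (‖κ n‖ * R)))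
      (g := fun n => 8 * ((L ^ 3) ^ N * ‖configFourierCoeff L Ψ.ψ n‖ ^ 2 -
        (L ^ 3) ^ N * ‖configFourierCoeff L Ψ.ψ n‖ ^ 2 * ∏ j, Real.sinc (κ n j * R / 2) ^ 2))
      (fun n => ?_) hD hdef
    · exact hcmp
    · have hwt := weight_ineq (R • κ n)
      have hnorm : ‖R • κ n‖ = ‖κ n‖ * R := by
        rw [norm_smul, Real.norm_eq_abs, abs_of_pos hR, mul_comm]
      have hcoord : ∀ j, (R • κ n) j / 2 = κ n j * R / 2 := fun j => by
        rw [PiLp.smul_apply, smul_eq_mul]; ring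
      rw [hnorm] at hwt
      simp_rw [hcoord] at hwt
      calc (L ^ 3) ^ N * ‖configFourierCoeff L Ψ.ψ n‖ ^ 2 * (1 - Real.cos (‖κ n‖ * R))
          ≤ (L ^ 3) ^ N * ‖configFourierCoeff L Ψ.ψ n‖ ^ 2 *
              (8 * (1 - ∏ j, Real.sinc (κ n j * R / 2) ^ 2)) :=
            mul_le_mul_of_nonneg_left hwt (ha0 n)
        _ = _ := by ring

end Summit.AtomisticToContinuum.BoseEinsteinCondensation.Theorems.CoreDeficitBounds

end
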